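import Mathlib.Analysis.Calculus.MeanValue
import Mathlib.Analysis.Calculus.ContDiff.Basic
import Mathlib.Analysis.Calculus.ContDiff.Operations
import Mathlib.Analysis.Calculus.ContDiff.FTaylorSeries
import Mathlib.Analysis.Calculus.Deriv.Basic
import Mathlib.Analysis.Calculus.TangentCone.Prod
import HarnessLib

/-!
# Joint smoothness from partial derivatives, within a time set (closed slabs)

Analysis/Calculus support file (everything proved, no named facts): the one-sided ("within")
companion of `Literature/Analysis/Calculus/JointSmoothnessPartials.lean`. There the time set
`I` is open; parabolic problems with initial data live on CLOSED time sets (`[0, ∞)`, `[0, T]`),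
where smoothness is Mathlib's `ContDiffOn` *within* the slab `I ×ˢ univ` (one-sided time
derivatives at the initial time, `UniqueDiffOn`). We prove:

* `hasFDerivWithinAt_of_partial` (**total within-differentiability from partial
  derivatives**): `f : E₁ × E₂ → G`, `I ⊆ E₁` convex; if the partial derivative in the first
  variable *within `I`* exists near `p₀` in `I × E₂` and is continuous at `p₀` within `I × E₂`,
  and the partial derivative in the second variable exists at `p₀`, then `f` has the expected
  total derivative at `p₀` within `I × E₂` (the mean value inequality along the segment
  `[p₀.1, p.1] ⊆ I`; Dieudonné (8.9.1)).
* `contDiffOn_succ_of_partial_within`: `C^{n+1}` within `I × E₂` from `Cⁿ` partial-derivative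
  fields (Mathlib's `contDiffOn_succ_iff_fderivWithin` on the `UniqueDiffOn` slab).
* `contDiffOn_iteratedFDeriv_of_mixed_partials_within` /
  `contDiffOn_uncurry_of_mixed_partials_within` (**joint `C^∞` smoothness within `I × E` from
  the family of mixed partials**): for `w : ℕ → ℝ → E → F` (`w (l+1)` the time derivative of
  `w l`, *within `I`*) with smooth slices, time derivatives within `I` of all spatial
  derivatives, and jointly continuous spatial derivatives on `I × E`, every `uncurry (w l)` is
  `C^∞` on `I ×ˢ univ` in the within sense. This is the form in which zero-initial-value heat
  solutions (smooth slices, time derivatives through the equation, continuity up to `t = 0`) are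
  shown to be smooth up to the initial time.

## References

* J. Dieudonné, *Foundations of Modern Analysis*, Academic Press 1960, (8.9.1), (8.12.x).
* S. Lang, *Real and Functional Analysis*, 3rd ed., Ch. XIII, Thm. 7.1 and §8.
-/

open Set Function Filter Topology Asymptotics Metric
open scoped Topology ContDiff

namespace Literature.Analysis.Calculus

/-! ### Total within-differentiability from partial derivatives -/

section Partial

variable {E₁ E₂ G : Type*} [NormedAddCommGroup E₁] [NormedSpace ℝ E₁] [NormedAddCommGroup E₂]
  [NormedSpace ℝ E₂] [NormedAddCommGroup G] [NormedSpace ℝ G]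

/-- **Within-differentiability from partial derivatives.** Let `I ⊆ E₁` be convex and
`p₀ ∈ I × E₂`. If the partial derivative of `f : E₁ × E₂ → G` in the first variable *within `I`*
exists near `p₀` in `I × E₂` and is continuous at `p₀` within `I × E₂`, and the partial
derivative in the second variable exists at `p₀`, then `f` is Fréchet differentiable at `p₀`
within `I × E₂`, with derivative `(h, k) ↦ ∂₁f(p₀) h + ∂₂f(p₀) k`. (Dieudonné (8.9.1), the mean
value inequality along segments of the convex set `I`.) [folklore] -/
theorem hasFDerivWithinAt_of_partial {f : E₁ × E₂ → G} {I : Set E₁} (hI : Convex ℝ I)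
    {p₀ : E₁ × E₂} (hp₀ : p₀.1 ∈ I) {f₁ : E₁ × E₂ → E₁ →L[ℝ] G} {L₂ : E₂ →L[ℝ] G}
    (h₁ : ∀ᶠ p in 𝓝[I ×ˢ univ] p₀, HasFDerivWithinAt (fun a => f (a, p.2)) (f₁ p) I p.1)
    (hc : ContinuousWithinAt f₁ (I ×ˢ univ) p₀)
    (h₂ : HasFDerivAt (fun b => f (p₀.1, b)) L₂ p₀.2) :
    HasFDerivWithinAt f ((f₁ p₀).comp (ContinuousLinearMap.fst ℝ E₁ E₂) +
      L₂.comp (ContinuousLinearMap.snd ℝ E₁ E₂)) (I ×ˢ univ) p₀ := by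
  rw [hasFDerivWithinAt_iff_isLittleO, Asymptotics.isLittleO_iff]
  intro c hc0
  -- the increment in the second variable, from `h₂`
  have hB : ∀ᶠ p : E₁ × E₂ in 𝓝[I ×ˢ univ] p₀,
      ‖f (p₀.1, p.2) - f (p₀.1, p₀.2) - L₂ (p.2 - p₀.2)‖ ≤ c / 2 * ‖p.2 - p₀.2‖ := by
    have h := Asymptotics.isLittleO_iff.1 h₂.isLittleO (half_pos hc0)
    have ht : Tendsto (fun p : E₁ × E₂ => p.2) (𝓝[I ×ˢ univ] p₀) (𝓝 p₀.2) :=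
      (continuous_snd.tendsto p₀).mono_left nhdsWithin_le_nhds
    exact ht.eventually h
  -- a ball on which `∂₁f` (within `I`) exists and is `c/2`-close to `∂₁f(p₀)`
  obtain ⟨δ, hδ, hδp⟩ : ∃ δ > 0, ∀ p : E₁ × E₂, p ∈ I ×ˢ (univ : Set E₂) → dist p p₀ < δ →
      HasFDerivWithinAt (fun a => f (a, p.2)) (f₁ p) I p.1 ∧ ‖f₁ p - f₁ p₀‖ ≤ c / 2 := by
    have hc' : ∀ᶠ p in 𝓝[I ×ˢ univ] p₀, ‖f₁ p - f₁ p₀‖ ≤ c / 2 := by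
      have h := hc.eventually_mem (closedBall_mem_nhds (f₁ p₀) (half_pos hc0))
      filter_upwards [h] with p hp
      rwa [mem_closedBall, dist_eq_norm] at hp
    obtain ⟨δ, hδ, h⟩ := Metric.eventually_nhds_iff.1 (eventually_nhdsWithin_iff.1 (h₁.and hc'))
    exact ⟨δ, hδ, fun p hp hd => h hd hp⟩
  -- the increment in the first variable, by the mean value inequality on `I ∩ ball`
  have hA : ∀ p : E₁ × E₂, p ∈ I ×ˢ (univ : Set E₂) → dist p p₀ < δ →
      ‖f (p.1, p.2) - f (p₀.1, p.2) - f₁ p₀ (p.1 - p₀.1)‖ ≤ c / 2 * ‖p.1 - p₀.1‖ := by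
    intro p hp hd
    have hp1 : p.1 ∈ I := (mem_prod.1 hp).1
    have hd2 : dist p.2 p₀.2 < δ := by
      refine lt_of_le_of_lt ?_ hd
      rw [Prod.dist_eq]
      exact le_max_right _ _
    set s : Set E₁ := I ∩ ball p₀.1 δ with hs
    have hsc : Convex ℝ s := hI.inter (convex_ball _ _)
    have hmem : ∀ a ∈ s, (a, p.2) ∈ I ×ˢ (univ : Set E₂) ∧ dist (a, p.2) p₀ < δ := by
      intro a ha
      refine ⟨mem_prod.2 ⟨ha.1, mem_univ _⟩, ?_⟩
      rw [Prod.dist_eq, max_lt_iff]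
      exact ⟨mem_ball.1 ha.2, hd2⟩
    have hder : ∀ a ∈ s, HasFDerivWithinAt (fun a => f (a, p.2)) (f₁ (a, p.2)) s a :=
      fun a ha => ((hδp (a, p.2) (hmem a ha).1 (hmem a ha).2).1).mono inter_subset_left
    have hbound : ∀ a ∈ s, ‖f₁ (a, p.2) - f₁ p₀‖ ≤ c / 2 := fun a ha =>
      (hδp (a, p.2) (hmem a ha).1 (hmem a ha).2).2
    have hx : p₀.1 ∈ s := ⟨hp₀, mem_ball_self hδ⟩
    have hd1 : dist p.1 p₀.1 < δ := by
      refine lt_of_le_of_lt ?_ hd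
      rw [Prod.dist_eq]
      exact le_max_left _ _
    have hy : p.1 ∈ s := ⟨hp1, mem_ball.2 hd1⟩
    exact hsc.norm_image_sub_le_of_norm_hasFDerivWithin_le' hder hbound hx hy
  have hsmall : ∀ᶠ p : E₁ × E₂ in 𝓝[I ×ˢ univ] p₀, p ∈ I ×ˢ (univ : Set E₂) ∧ dist p p₀ < δ := by
    refine eventually_nhdsWithin_iff.2 (Metric.eventually_nhds_iff.2 ⟨δ, hδ, fun p hd hp => ⟨hp, hd⟩⟩)
  filter_upwards [hB, hsmall] with p hBp hp
  have hAp := hA p hp.1 hp.2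
  have hsplit : f p - f p₀ - ((f₁ p₀).comp (ContinuousLinearMap.fst ℝ E₁ E₂) +
      L₂.comp (ContinuousLinearMap.snd ℝ E₁ E₂)) (p - p₀) =
      (f (p.1, p.2) - f (p₀.1, p.2) - f₁ p₀ (p.1 - p₀.1)) +
        (f (p₀.1, p.2) - f (p₀.1, p₀.2) - L₂ (p.2 - p₀.2)) := by
    simp only [FunLike.coe_add, Pi.add_apply, ContinuousLinearMap.comp_apply,
      ContinuousLinearMap.coe_fst', ContinuousLinearMap.coe_snd', Prod.fst_sub, Prod.snd_sub,
      Prod.mk.eta]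
    abel
  rw [hsplit]
  calc ‖(f (p.1, p.2) - f (p₀.1, p.2) - f₁ p₀ (p.1 - p₀.1)) +
        (f (p₀.1, p.2) - f (p₀.1, p₀.2) - L₂ (p.2 - p₀.2))‖
      ≤ c / 2 * ‖p.1 - p₀.1‖ + c / 2 * ‖p.2 - p₀.2‖ := norm_add_le_of_le hAp hBp
    _ ≤ c / 2 * ‖p - p₀‖ + c / 2 * ‖p - p₀‖ := by
        gcongr
        · exact norm_fst_le (p - p₀)
        · exact norm_snd_le (p - p₀)
    _ = c * ‖p - p₀‖ := by ring

/-- **`C^{n+1}` within a slab from `Cⁿ` partial derivatives.** Let `I ⊆ E₁` be convex with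
`UniqueDiffOn ℝ I`. If the partial derivative of `f` in the first variable within `I` and the
partial derivative in the second variable exist on `I × E₂` and are `Cⁿ` there (within), then
`f` is `C^{n+1}` on `I × E₂` within, with `fderivWithin f (I × E₂) = ∂₁f ∘ pr₁ + ∂₂f ∘ pr₂`.
(Dieudonné (8.12.x); Lang XIII §7.) [folklore] -/
theorem contDiffOn_succ_of_partial_within {f : E₁ × E₂ → G} {I : Set E₁} (hI : Convex ℝ I)
    (hIu : UniqueDiffOn ℝ I) {f₁ : E₁ × E₂ → E₁ →L[ℝ] G} {f₂ : E₁ × E₂ → E₂ →L[ℝ] G} {n : ℕ}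
    (h₁ : ∀ p ∈ I ×ˢ (univ : Set E₂), HasFDerivWithinAt (fun a => f (a, p.2)) (f₁ p) I p.1)
    (h₂ : ∀ p ∈ I ×ˢ (univ : Set E₂), HasFDerivAt (fun b => f (p.1, b)) (f₂ p) p.2)
    (hc₁ : ContDiffOn ℝ n f₁ (I ×ˢ univ)) (hc₂ : ContDiffOn ℝ n f₂ (I ×ˢ univ)) :
    ContDiffOn ℝ (n + 1) f (I ×ˢ univ) := by
  have hS : UniqueDiffOn ℝ (I ×ˢ (univ : Set E₂)) := hIu.prod uniqueDiffOn_univ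
  have hd : ∀ p ∈ I ×ˢ (univ : Set E₂), HasFDerivWithinAt f
      ((f₁ p).comp (ContinuousLinearMap.fst ℝ E₁ E₂) +
        (f₂ p).comp (ContinuousLinearMap.snd ℝ E₁ E₂)) (I ×ˢ univ) p := fun p hp =>
    hasFDerivWithinAt_of_partial hI (mem_prod.1 hp).1
      (eventually_nhdsWithin_of_forall fun q hq => h₁ q hq) (hc₁.continuousOn.continuousWithinAt hp)
      (h₂ p hp)
  refine (contDiffOn_succ_iff_fderivWithin hS).2
    ⟨fun p hp => (hd p hp).differentiableWithinAt, fun h => (WithTop.natCast_ne_top n h).elim, ?_⟩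
  have heq : EqOn (fun p => fderivWithin ℝ f (I ×ˢ univ) p)
      (fun p => (f₁ p).comp (ContinuousLinearMap.fst ℝ E₁ E₂) +
        (f₂ p).comp (ContinuousLinearMap.snd ℝ E₁ E₂)) (I ×ˢ univ) := fun p hp =>
    (hd p hp).fderivWithin (hS p hp)
  exact ((hc₁.clm_comp contDiffOn_const).add (hc₂.clm_comp contDiffOn_const)).congr heq

end Partial

/-! ### Joint smoothness within `I × E` from the family of mixed partial derivatives -/

section Mixed

variable {E F : Type*} [NormedAddCommGroup E] [NormedSpace ℝ E] [NormedAddCommGroup F]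
  [NormedSpace ℝ F]

/-- **Joint smoothness of all mixed partials, within a time set.** Let `I ⊆ ℝ` be convex with
`UniqueDiffOn ℝ I` (e.g. `[0, ∞)`, `[0, T]`) and `w : ℕ → ℝ → E → F` (think `w l = ∂ₜˡ v`) be
such that: every slice `w l t` (`t ∈ I`) is `C^∞`; for all `k, l`, `t ∈ I`, `x`, the map
`τ ↦ Dᵏ(w l τ)(x)` has derivative `Dᵏ(w (l+1) t)(x)` at `t` *within `I`*; and every
`(t, x) ↦ Dᵏ(w l t)(x)` is continuous on `I × E`. Then for every `n, k, l` the map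
`(t, x) ↦ Dᵏ(w l t)(x)` is `Cⁿ` on `I × E` within. [folklore] -/
theorem contDiffOn_iteratedFDeriv_of_mixed_partials_within {I : Set ℝ} (hI : Convex ℝ I)
    (hIu : UniqueDiffOn ℝ I) {w : ℕ → ℝ → E → F} (hx : ∀ l, ∀ t ∈ I, ContDiff ℝ ∞ (w l t))
    (ht : ∀ k l : ℕ, ∀ t ∈ I, ∀ x : E,
      HasDerivWithinAt (fun τ => iteratedFDeriv ℝ k (w l τ) x) (iteratedFDeriv ℝ k (w (l + 1) t) x) I t)
    (hc : ∀ k l : ℕ, ContinuousOn (fun p : ℝ × E => iteratedFDeriv ℝ k (w l p.1) p.2) (I ×ˢ univ))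
    (n k l : ℕ) :
    ContDiffOn ℝ n (fun p : ℝ × E => iteratedFDeriv ℝ k (w l p.1) p.2) (I ×ˢ univ) := by
  induction n generalizing k l with
  | zero => exact contDiffOn_zero.2 (hc k l)
  | succ n ih =>
    -- the two partial-derivative fields of `g (t, x) = Dᵏ(w l t)(x)`
    set A : ℝ × E → ℝ →L[ℝ] (E [×k]→L[ℝ] F) := fun p =>
      (1 : ℝ →L[ℝ] ℝ).smulRight (iteratedFDeriv ℝ k (w (l + 1) p.1) p.2) with hA
    set B : ℝ × E → E →L[ℝ] (E [×k]→L[ℝ] F) := fun p =>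
      fderiv ℝ (iteratedFDeriv ℝ k (w l p.1)) p.2 with hB
    have hAd : ∀ p ∈ I ×ˢ (univ : Set E), HasFDerivWithinAt
        (fun a : ℝ => iteratedFDeriv ℝ k (w l a) p.2) (A p) I p.1 := fun p hp =>
      (ht k l p.1 (mem_prod.1 hp).1 p.2).hasFDerivWithinAt
    have hlt : ((k : ℕ∞) : WithTop ℕ∞) < ∞ := WithTop.coe_lt_coe.2 (ENat.coe_lt_top k)
    have hBd : ∀ p ∈ I ×ˢ (univ : Set E), HasFDerivAt
        (fun b : E => iteratedFDeriv ℝ k (w l p.1) b) (B p) p.2 := fun p hp =>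
      ((hx l p.1 (mem_prod.1 hp).1).differentiable_iteratedFDeriv (by exact_mod_cast hlt) p.2).hasFDerivAt
    have hAc : ContDiffOn ℝ n A (I ×ˢ univ) := ContDiffOn.smulRight contDiffOn_const (ih k (l + 1))
    -- `fderiv ∘ Dᵏ = curry ∘ Dᵏ⁺¹` (`fderiv_iteratedFDeriv`), and currying is a linear isometry
    have hBc : ContDiffOn ℝ n B (I ×ˢ univ) := by
      have h := ContDiffOn.continuousLinearMap_comp (𝕜 := ℝ) (F := E [×(k + 1)]→L[ℝ] F)
        (G := E →L[ℝ] E [×k]→L[ℝ] F)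
        ((continuousMultilinearCurryLeftEquiv ℝ (fun _ : Fin (k + 1) => E) F).toLinearIsometry.toContinuousLinearMap)
        (ih (k + 1) l)
      refine h.congr fun p _ => ?_
      show fderiv ℝ (iteratedFDeriv ℝ k (w l p.1)) p.2 = _
      rw [fderiv_iteratedFDeriv]
      rfl
    exact contDiffOn_succ_of_partial_within (f := fun p : ℝ × E => iteratedFDeriv ℝ k (w l p.1) p.2)
      hI hIu hAd hBd hAc hBc

/-- **Joint `C^∞` smoothness within `I × E` from the family of mixed partials.** Under the
hypotheses of `contDiffOn_iteratedFDeriv_of_mixed_partials_within`, every field `w l` is jointly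
`C^∞` on `I × E` in the within sense: `ContDiffOn ℝ ∞ (uncurry (w l)) (I ×ˢ univ)`; in
particular so is `w 0`. For `I = [0, ∞)` or `[0, T]` this is smoothness up to the initial time.
[folklore] -/
theorem contDiffOn_uncurry_of_mixed_partials_within {I : Set ℝ} (hI : Convex ℝ I)
    (hIu : UniqueDiffOn ℝ I) {w : ℕ → ℝ → E → F} (hx : ∀ l, ∀ t ∈ I, ContDiff ℝ ∞ (w l t))
    (ht : ∀ k l : ℕ, ∀ t ∈ I, ∀ x : E,
      HasDerivWithinAt (fun τ => iteratedFDeriv ℝ k (w l τ) x) (iteratedFDeriv ℝ k (w (l + 1) t) x) I t)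
    (hc : ∀ k l : ℕ, ContinuousOn (fun p : ℝ × E => iteratedFDeriv ℝ k (w l p.1) p.2) (I ×ˢ univ))
    (l : ℕ) :
    ContDiffOn ℝ ∞ (uncurry (w l)) (I ×ˢ univ) := by
  rw [contDiffOn_infty]
  intro n
  have h0 := contDiffOn_iteratedFDeriv_of_mixed_partials_within hI hIu hx ht hc n 0 l
  set ev0 : (E [×0]→L[ℝ] F) →L[ℝ] F :=
    (continuousMultilinearCurryFin0 ℝ E F).toLinearIsometry.toContinuousLinearMap with hev0
  have heq : uncurry (w l) = ev0 ∘ fun p : ℝ × E => iteratedFDeriv ℝ 0 (w l p.1) p.2 := by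
    funext p
    rfl
  rw [heq]
  exact ev0.contDiff.comp_contDiffOn h0

end Mixed

end Literature.Analysis.Calculus
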